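import Summits.QuantumFields.YangMills.Theorems.BalabanUVNodesN15PerCubeGreenTwoGridSecondLettersOfReg335LipCube
import Literature.MathematicalPhysics.QuantumFieldTheory.Balaban1983to89.B11Reg910Classes
import HarnessLib

/-!
# N15 = NE2, road (c) — PROGRAMME (PC) «[B9] Sect. C FOR THE LANDAU LETTER WITH PER-CUBE GAUGES», (PC-E-H) THE HÖLDER-NATIVE DIVERGENCE FIT, PART 2: THE DATUM `Reg335HolderCube`
# = (3.35) + THE PRINTED HÖLDER CLAUSE OF [B11] THM 1 (9) AT ONE EXPONENT `β` (the fifth clause of dag-n07-a's `B11Reg910Classes.Reg910Cube`, pairwise, with its distance parameter),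
# THE PAIRWISE FOUR-POINT GROUP LETTER IT GIVES, AND THE BRIDGE FROM THE PRINTED CLASS `Reg910Cube` WITH NO `η`-DEPENDENT CONSTANT (dag-n15-c g34, n15-c∕370)

Cell `pub-ymgap`, seat `pub-ymgap-dag-n15-c` (generation g34; R134 (a) seat, strategy s1 «first missing estimate»; HUMAN RULING D-0062; chair R424 venue).
`bears_on: R4∕N15 · K3⁸ SpineGivenEndpointR13SepCoPHV (stmt-QuantumFields-27366)`; filed `--kind definition --supports stmt-QuantumFields-27366 --as helper` — COUNT-NEUTRAL.
ONE `def` (`Reg335HolderCube`, review lane) + theorems; 0 `sorry`.  Imports BY NAME n15-c∕360 `…SecondLettersOfReg335LipCube` (through it n15-c∕356 `norm_exp_fourPoint_le`, dag-n15-w2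
`…CurvedLocalSpeciesOfReg335UN` `bondLetters_of_gauge335` ∕ `uN_opLetters_of_gauge335` ∕ `uN_val_gaugeTr_eq` ∕ `norm_I_eta_smul` ∕ `covD_one_apply'`, r06 `B9Eq335RegularityClasses`
`Reg335Cube` ∕ `norm_le_eta_mul_of_norm_inv_smul_lt`, `B9Eq39Adjoint` `covD` ∕ `fluct`, `B9Eq3117Current` `gaugeTr`) and dag-n07-a's `B11Reg910Classes` (`Reg910Cube`).  Nothing in the tree
is modified, no landed name re-declared.

WHY (HOME memo `EVIDENCE-N15C-G33-DIVERGENCE-FIT.md` §4–§5 (H); n15-c∕368's docstring).  The g33 chain (n15-c∕357∕358∕361–364) consumes the third regularity letter PER LATTICE STEP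
(`Reg335LipCube`'s flat second difference `C₁ξ⁻³`, the `β = 1` endpoint of (9)); Hölder-`β` data with `β < 1` — what the series' proofs deliver ([Balaban1985RegularSpaces] Thm 2 (1.36):
`β ≤ β₀ < 1`; cell GAPS C-B8-18) — enter it only through the `η`-dependent constant `C₁ = C_β(ξ∕η′)^{1−β}` (n15-c∕360 v1.1, n15-c∕367), whence a rate `O(L^{r(1−β)}η^β)` NOT uniform in
the fine spacing.  The printed clause (9) «‖A‖_{1,β} < B₄(β₀)Mε₁(Lʲη)^{−2−β}» is PAIRWISE ((3.40)∕(1.109): `sup_{|x−x′| ≤ 1} |∇A(x) − ∇A(x′)|∕|x − x′|^β`), and read pairwise it gives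
the divergence fit at order `η^β` with NO window sum (n15-c∕368∕369).  THIS FILE types the per-cube datum in that form and derives the group-level PAIRWISE four-point letter:
* §1 ★ `Reg335HolderCube T U η □ ξ dist C β Cβ` — r06's (3.35) four clauses + «`‖η⁻¹D¹_κA_ν(z′) − η⁻¹D¹_κA_ν(z)‖ < C_β·ξ^{−(2+β)}·dist(z,z′)^β` for `z, z′ ∈ □`, `0 < dist(z,z′) ≤ 1`»
  = the fifth clause of `B11Reg910Classes.Reg910Cube` AT ONE `β` (there: `∀ β ∈ [0, β₀]`), same carrier ∕ vocabulary ∕ distance parameter; `Reg335HolderCube.reg335Cube`;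
  ★★ `Reg910Cube.reg335HolderCube` — THE BRIDGE FROM PRINT: [B11] Thm 1 (9)–(10) on □ AS TYPED ⟹ the datum at every `β ∈ [0, β₀]` with `C_β := C₄` (NO factor `(ξ∕η)^{1−β}`, contrast n15-c∕367).
* §2 ★★ `pairLetter_of_gauge335Holder` — for a gauge datum `(u, A)` with the clauses as binders: at `z, z′ ∈ □` with `z+e_κ, z′+e_κ ∈ □`, `dist(z,z′) ≤ ρ ≤ 1`, `z ≠ z′ → 0 < dist(z,z′)`:
  `‖(U^u_μ(z+e_κ) − U^u_μ(z)) − (U^u_μ(z′+e_κ) − U^u_μ(z′))‖ ≤ η²·(C_βξ^{−(2+β)}ρ^β + 2η(C∕ξ)(C∕ξ²))·e^{5ηC∕ξ}` (n15-c∕356 `norm_exp_fourPoint_le` at the four exponents `iηA_μ(·)`, second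
  difference `iη·η·(∇_κA_μ(z′) − ∇_κA_μ(z))`, first differences `iη·η∇_κA_μ(z)` and `iη(A_μ(z′) − A_μ(z))`, the latter bounded by `2ηC∕ξ` — no path between `z` and `z′` is needed);
  ★★ `exists_gauge_pairLetters_of_reg335HolderCube` (∃-form, with the pointwise and step letters of dag-n15-w2 `bondLetters_of_gauge335`).
* §3 (`𝔸 = M_n(ℂ)`, operator norm) ★★★ `uN_exists_gauge_pairLetters_of_reg335HolderCube`: a gauge UNITARY EVERYWHERE (the datum's on `Q`, `1` off `Q`) with the pointwise letter, the
  all-direction step letter and the PAIRWISE four-point letter of `V_μ(z) = w(z)U_μ(z)w(z+e_μ)ᴴ` — the per-cube input of n15-c∕369∕371.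
* §4 `reg335HolderCube_one` (non-vacuity: `U ≡ 1`, `u ≡ 1`, `A ≡ 0`).

HONEST FRAMING ∕ LIMITS.  The datum is a HYPOTHESIS shape — the printed per-cube regularity (9) of [Balaban1985Variational] Thm 1 read pairwise at one exponent; its PRODUCTION from small
plaquette variables is node N04∕N07's theorem ([Balaban1985RegularSpaces] Thm 2, [Balaban1985Variational] Thm 1), NOT claimed; the bridge of §1 is definitional unpacking of dag-n07-a's typed
class.  Exponential-series bookkeeping in a Banach algebra; nothing of [B9]∕[B11] asserted.  NE2⁺ NOT PRINTED ∕ NOT proved; N15 of record untouched (DISCHARGED AS CONSUMED, p687738); K3⁸ OPEN;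
counts of record UNMOVED (typed 28∕28 · discharged 8∕27); one finite 𝕋⁴ at fixed ε per index — NOT infinite volume, NOT OS on ℝ⁴, NOT a mass gap, NOT Clay.  Restate-immune (no Theses import).
-/

set_option autoImplicit false

noncomputable section

open scoped BigOperators Matrix

namespace Summit.QuantumFields.YangMills.BalabanUVNodes.N15.CurvedSpecies

/-! ## §1 The datum: (3.35) + the Hölder clause of (9) at one exponent, pairwise, with the distance parameter -/

section Generic

open NormedSpace
open Literature.MathematicalPhysics.QuantumFieldTheory.Balaban1983to89
open Literature.MathematicalPhysics.QuantumFieldTheory.Balaban1983to89.B9Eq39Adjoint (covD fluct)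
open Literature.MathematicalPhysics.QuantumFieldTheory.Balaban1983to89.B9Eq3117Current (gaugeTr)
open Literature.MathematicalPhysics.QuantumFieldTheory.Balaban1983to89.B9Eq335RegularityClasses (Reg335Cube norm_le_eta_mul_of_norm_inv_smul_lt)
open Literature.MathematicalPhysics.QuantumFieldTheory.Balaban1983to89.B11Reg910Classes (Reg910Cube)

variable {𝔸 : Type*} [NormedRing 𝔸] [NormedAlgebra ℂ 𝔸] [CompleteSpace 𝔸] {S ι : Type*} (T : ι → Equiv.Perm S) (U : ι → S → 𝔸ˣ)

/-- ★ **THE DATUM (3.35) + THE HÖLDER CLAUSE OF (9) AT ONE EXPONENT `β`** — r06's `Reg335Cube T U η □ ξ C` («there exists a gauge transformation u on □ such that U^u = e^{iηA} …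
|A| < Cξ⁻¹, |∇^ηA| < Cξ⁻² on □», flat `∇^η = η⁻¹D¹`) TOGETHER WITH the pairwise Hölder bound «‖∇^η_κA_ν(z′) − ∇^η_κA_ν(z)‖ < C_β·ξ^{−(2+β)}·dist(z,z′)^β for z, z′ ∈ □,
0 < dist(z,z′) ≦ 1» — the finite supremum (3.40)∕(1.109) «‖A‖_{1,β} = max_{μ,ν} sup_{|x−x′| ≦ 1} |∇_μA_ν(x) − ∇_μA_ν(x′)|∕|x−x′|^β» in pointwise strict form, VERBATIM the fifth clause of
dag-n07-a's `B11Reg910Classes.Reg910Cube` at ONE exponent (`dist` = the η-scale distance, a parameter, reading D-n07a-4).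
[cite: Balaban1985Variational, Thm 1 (9) p.279; Balaban1985BackgroundPropagators, (3.35) p.396, (3.40) p.397; Balaban1984PropagatorsI, (1.109) p.35] -/
def Reg335HolderCube (η : ℝ) (cube : Set S) (ξ : ℝ) (dist : S → S → ℝ) (C β Cβ : ℝ) : Prop :=
  ∃ (u : S → 𝔸ˣ) (A : ι → S → 𝔸),
    (∀ z ∈ cube, ‖(u z : 𝔸)‖ ≤ 1 ∧ ‖(((u z)⁻¹ : 𝔸ˣ) : 𝔸)‖ ≤ 1) ∧
    (∀ κ, ∀ z ∈ cube, gaugeTr T u U κ z = fluct η A κ z) ∧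
    (∀ κ, ∀ z ∈ cube, ‖A κ z‖ < C * ξ⁻¹) ∧
    (∀ κ ν, ∀ z ∈ cube, ‖((η : ℂ)⁻¹) • covD T (fun _ _ => (1 : 𝔸ˣ)) κ (A ν) z‖ < C * (ξ ^ 2)⁻¹) ∧
    (∀ κ ν, ∀ z ∈ cube, ∀ z' ∈ cube, 0 < dist z z' → dist z z' ≤ 1 →
      ‖((η : ℂ)⁻¹) • covD T (fun _ _ => (1 : 𝔸ˣ)) κ (A ν) z' - ((η : ℂ)⁻¹) • covD T (fun _ _ => (1 : 𝔸ˣ)) κ (A ν) z‖ < Cβ * (ξ ^ (2 + β))⁻¹ * dist z z' ^ β)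

/-- The datum contains r06's (3.35) datum on the cube. [cite: Balaban1985BackgroundPropagators, (3.35) p.396] -/
theorem Reg335HolderCube.reg335Cube {η : ℝ} {cube : Set S} {ξ : ℝ} {dist : S → S → ℝ} {C β Cβ : ℝ} (h : Reg335HolderCube T U η cube ξ dist C β Cβ) :
    Reg335Cube T U η cube ξ C := by
  obtain ⟨u, A, hu, hg, hA, hD, -⟩ := h
  exact ⟨u, A, hu, hg, hA, hD⟩

/-- ★★ **THE BRIDGE FROM PRINT** — [B11] Thm 1 (9)–(10) on □ AS TYPED (`B11Reg910Classes.Reg910Cube T U η □ ξ dist C C₄ β₀`) ⟹ the datum at every exponent `β ∈ [0, β₀]` with the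
printed constant `C_β := C₄ = B₄(β₀)Mε₁` — NO `η`-dependent factor (contrast n15-c∕367 `reg335LipCube_interior_of_reg910Cube`: `C₁ := C₄(ξ∕η)^{1−β}`).  Definitional unpacking.
[cite: Balaban1985Variational, Thm 1 (9)–(10) p.279] -/
theorem _root_.Literature.MathematicalPhysics.QuantumFieldTheory.Balaban1983to89.B11Reg910Classes.Reg910Cube.reg335HolderCube [Fintype ι] [LinearOrder ι]
    {η : ℝ} {cube : Set S} {ξ : ℝ} {dist : S → S → ℝ} {C C₄ β₀ : ℝ} (h : Reg910Cube T U η cube ξ dist C C₄ β₀) {β : ℝ} (hβ : 0 ≤ β) (hββ₀ : β ≤ β₀) :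
    Reg335HolderCube T U η cube ξ dist C β C₄ := by
  obtain ⟨u, A, hu, hg, hA, hD, hH, -, -⟩ := h
  exact ⟨u, A, hu, hg, hA, hD, fun κ ν z hz z' hz' h0 h1 => hH β hβ hββ₀ κ ν z hz z' hz' h0 h1⟩

/-! ## §2 The pairwise four-point group letter in the datum's gauge -/

variable [NormOneClass 𝔸]

/-- ★★ **THE PAIRWISE FOUR-POINT GROUP LETTER IN THE CUBE GAUGE** — for a gauge datum `(u, A)` with the clauses of `Reg335HolderCube` as binders (`u`, `A` free), `η, ξ > 0`, `0 ≤ β`,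
`0 ≤ C_β`: at `z, z′ ∈ □` with `z+e_κ, z′+e_κ ∈ □`, `dist(z,z′) ≤ ρ ≤ 1` (`0 ≤ ρ`) and `z ≠ z′ → 0 < dist(z,z′)`:
`‖(U^u_μ(z+e_κ) − U^u_μ(z)) − (U^u_μ(z′+e_κ) − U^u_μ(z′))‖ ≤ η²·(C_β·ξ^{−(2+β)}·ρ^β + 2η·(C∕ξ)(C∕ξ²))·e^{5ηC∕ξ}` (`U^u_μ = exp(iηA_μ)` at the four points; n15-c∕356 `norm_exp_fourPoint_le`
with `s = ηC∕ξ`: the exponents' second difference is `iη·η·(∇_κA_μ(z′) − ∇_κA_μ(z))`, the first differences are `iη·η∇_κA_μ(z)` and `iη(A_μ(z′) − A_μ(z))`, the latter `≤ 2ηC∕ξ` —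
NO lattice path from `z` to `z′` is used). [cite: Balaban1985Variational, Thm 1 (9) p.279 (shape); Balaban1985BackgroundPropagators, (3.35) p.396, (3.40) p.397 (shape), Cor. 3.6 p.408
(«U′ = U^u = e^{iηA}»)] -/
theorem pairLetter_of_gauge335Holder {η : ℝ} (hη : 0 < η) {cube : Set S} {ξ : ℝ} (hξ : 0 < ξ) {dist : S → S → ℝ} {C β Cβ : ℝ} (hβ : 0 ≤ β) (hCβ : 0 ≤ Cβ)
    {u : S → 𝔸ˣ} {A : ι → S → 𝔸}
    (hg : ∀ κ, ∀ z ∈ cube, gaugeTr T u U κ z = fluct η A κ z) (hA : ∀ κ, ∀ z ∈ cube, ‖A κ z‖ < C * ξ⁻¹)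
    (hD : ∀ κ ν, ∀ z ∈ cube, ‖((η : ℂ)⁻¹) • covD T (fun _ _ => (1 : 𝔸ˣ)) κ (A ν) z‖ < C * (ξ ^ 2)⁻¹)
    (hH : ∀ κ ν, ∀ z ∈ cube, ∀ z' ∈ cube, 0 < dist z z' → dist z z' ≤ 1 →
      ‖((η : ℂ)⁻¹) • covD T (fun _ _ => (1 : 𝔸ˣ)) κ (A ν) z' - ((η : ℂ)⁻¹) • covD T (fun _ _ => (1 : 𝔸ˣ)) κ (A ν) z‖ < Cβ * (ξ ^ (2 + β))⁻¹ * dist z z' ^ β)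
    (κ μ : ι) (z z' : S) (hz : z ∈ cube) (hzκ : T κ z ∈ cube) (hz' : z' ∈ cube) (hz'κ : T κ z' ∈ cube)
    {ρ : ℝ} (hρ0 : 0 ≤ ρ) (hρ : dist z z' ≤ ρ) (hρ1 : ρ ≤ 1) (hpos : z ≠ z' → 0 < dist z z') :
    ‖((gaugeTr T u U μ (T κ z) : 𝔸) - gaugeTr T u U μ z) - ((gaugeTr T u U μ (T κ z') : 𝔸) - gaugeTr T u U μ z')‖ ≤
      η ^ 2 * ((Cβ * (ξ ^ (2 + β))⁻¹ * ρ ^ β + 2 * η * ((C / ξ) * (C / ξ ^ 2))) * Real.exp (5 * (η * (C / ξ)))) := by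
  have hCpos : 0 < C := by
    have h1 := (norm_nonneg _).trans_lt (hA κ z hz)
    by_contra h2
    have h3 : C ≤ 0 := not_lt.mp h2
    nlinarith [inv_pos.mpr hξ]
  have hRHS : 0 ≤ η ^ 2 * ((Cβ * (ξ ^ (2 + β))⁻¹ * ρ ^ β + 2 * η * ((C / ξ) * (C / ξ ^ 2))) * Real.exp (5 * (η * (C / ξ)))) := by
    have : 0 ≤ ρ ^ β := Real.rpow_nonneg hρ0 β
    have : 0 < ξ ^ (2 + β) := Real.rpow_pos_of_pos hξ _
    positivity
  by_cases hzz : z = z'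
  · subst hzz
    rw [sub_self, norm_zero]
    exact hRHS
  have hd0 : 0 < dist z z' := hpos hzz
  have hd1 : dist z z' ≤ 1 := hρ.trans hρ1
  -- sizes of the exponents
  have hX : ∀ w ∈ cube, ‖(Complex.I * η : ℂ) • A μ w‖ ≤ η * (C / ξ) := fun w hw => by
    rw [norm_I_eta_smul hη.le]
    exact mul_le_mul_of_nonneg_left (by rw [div_eq_mul_inv]; exact (hA μ w hw).le) hη.le
  have hval : ∀ w ∈ cube, (gaugeTr T u U μ w : 𝔸) = exp ((Complex.I * η : ℂ) • A μ w) := fun w hw => by rw [hg μ w hw, val_fluct]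
  -- first difference along `κ` at `z`
  have hd1κ : ‖(Complex.I * η : ℂ) • A μ (T κ z) - (Complex.I * η : ℂ) • A μ z‖ ≤ η * (η * (C * (ξ ^ 2)⁻¹)) := by
    rw [← smul_sub, ← covD_one_apply' T, norm_I_eta_smul hη.le]
    exact mul_le_mul_of_nonneg_left (norm_le_eta_mul_of_norm_inv_smul_lt hη (hD κ μ z hz)) hη.le
  -- the jump `z → z′`: pointwise letter twice
  have hdj : ‖(Complex.I * η : ℂ) • A μ z' - (Complex.I * η : ℂ) • A μ z‖ ≤ 2 * (η * (C / ξ)) :=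
    (norm_sub_le _ _).trans (by linarith [hX z' hz', hX z hz])
  -- the second difference: the PAIRWISE Hölder clause
  have hd2 : ‖(Complex.I * η : ℂ) • A μ (T κ z') - (Complex.I * η : ℂ) • A μ (T κ z) - (Complex.I * η : ℂ) • A μ z' + (Complex.I * η : ℂ) • A μ z‖ ≤
      η ^ 2 * (Cβ * (ξ ^ (2 + β))⁻¹ * ρ ^ β) := by
    have hη0 : (η : ℂ) ≠ 0 := by exact_mod_cast hη.ne'
    have e1 : (Complex.I * η : ℂ) • A μ (T κ z') - (Complex.I * η : ℂ) • A μ (T κ z) - (Complex.I * η : ℂ) • A μ z' + (Complex.I * η : ℂ) • A μ z =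
        (Complex.I * η : ℂ) • ((η : ℂ) • (((η : ℂ)⁻¹) • covD T (fun _ _ => (1 : 𝔸ˣ)) κ (A μ) z' - ((η : ℂ)⁻¹) • covD T (fun _ _ => (1 : 𝔸ˣ)) κ (A μ) z)) := by
      rw [smul_sub, smul_inv_smul₀ hη0, smul_inv_smul₀ hη0, covD_one_apply', covD_one_apply', smul_sub, smul_sub, smul_sub]
      abel
    have h3 := (hH κ μ z hz z' hz' hd0 hd1).le
    have hρβ : dist z z' ^ β ≤ ρ ^ β := Real.rpow_le_rpow hd0.le hρ hβ
    have hξβ : 0 ≤ Cβ * (ξ ^ (2 + β))⁻¹ := mul_nonneg hCβ (inv_pos.mpr (Real.rpow_pos_of_pos hξ _)).le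
    rw [e1, norm_I_eta_smul hη.le, norm_smul, Complex.norm_real, Real.norm_of_nonneg hη.le]
    calc η * (η * ‖((η : ℂ)⁻¹) • covD T (fun _ _ => (1 : 𝔸ˣ)) κ (A μ) z' - ((η : ℂ)⁻¹) • covD T (fun _ _ => (1 : 𝔸ˣ)) κ (A μ) z‖)
        ≤ η * (η * (Cβ * (ξ ^ (2 + β))⁻¹ * dist z z' ^ β)) := by gcongr
      _ ≤ η * (η * (Cβ * (ξ ^ (2 + β))⁻¹ * ρ ^ β)) := by gcongr
      _ = η ^ 2 * (Cβ * (ξ ^ (2 + β))⁻¹ * ρ ^ β) := by ring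
  -- the four-point estimate of the exponentials
  have e4 : ((gaugeTr T u U μ (T κ z) : 𝔸) - gaugeTr T u U μ z) - ((gaugeTr T u U μ (T κ z') : 𝔸) - gaugeTr T u U μ z') =
      -((gaugeTr T u U μ (T κ z') : 𝔸) - gaugeTr T u U μ (T κ z) - gaugeTr T u U μ z' + gaugeTr T u U μ z) := by abel
  rw [e4, norm_neg, hval _ hz'κ, hval _ hzκ, hval _ hz', hval _ hz]
  refine (norm_exp_fourPoint_le _ _ _ _ (hX z hz) (hX _ hzκ) (hX _ hz') (hX _ hz'κ)).trans ?_
  have hC2 : 0 ≤ η * (η * (C * (ξ ^ 2)⁻¹)) := (norm_nonneg _).trans hd1κ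
  calc (‖(Complex.I * η : ℂ) • A μ (T κ z') - (Complex.I * η : ℂ) • A μ (T κ z) - (Complex.I * η : ℂ) • A μ z' + (Complex.I * η : ℂ) • A μ z‖ +
          ‖(Complex.I * η : ℂ) • A μ (T κ z) - (Complex.I * η : ℂ) • A μ z‖ * ‖(Complex.I * η : ℂ) • A μ z' - (Complex.I * η : ℂ) • A μ z‖) * Real.exp (5 * (η * (C / ξ)))
      ≤ (η ^ 2 * (Cβ * (ξ ^ (2 + β))⁻¹ * ρ ^ β) + (η * (η * (C * (ξ ^ 2)⁻¹))) * (2 * (η * (C / ξ)))) * Real.exp (5 * (η * (C / ξ))) := by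
        refine mul_le_mul_of_nonneg_right (add_le_add hd2 (mul_le_mul hd1κ hdj (norm_nonneg _) hC2)) (Real.exp_pos _).le
    _ = η ^ 2 * ((Cβ * (ξ ^ (2 + β))⁻¹ * ρ ^ β + 2 * η * ((C / ξ) * (C / ξ ^ 2))) * Real.exp (5 * (η * (C / ξ)))) := by rw [div_eq_mul_inv C (ξ ^ 2)]; ring

/-- ★★ (∃-form) the datum on a cube ⟹ a gauge of unitary type on □ with the pointwise letter `‖U^u_κ − 1‖ ≤ η(C∕ξ)e^{ηC∕ξ}` on □, the all-direction step letter
`‖U^u_ν(z+e_κ) − U^u_ν(z)‖ ≤ η²(C∕ξ²)e^{ηC∕ξ}` (`z, z+e_κ ∈ □`) and the PAIRWISE four-point letter of `pairLetter_of_gauge335Holder`.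
[cite: Balaban1985BackgroundPropagators, (3.35) p.396 (shape), Cor. 3.6 p.408; Balaban1985Variational, Thm 1 (9) p.279 (shape)] -/
theorem exists_gauge_pairLetters_of_reg335HolderCube {η : ℝ} (hη : 0 < η) {cube : Set S} {ξ : ℝ} (hξ : 0 < ξ) {dist : S → S → ℝ} {C β Cβ : ℝ} (hβ : 0 ≤ β) (hCβ : 0 ≤ Cβ)
    (h : Reg335HolderCube T U η cube ξ dist C β Cβ) :
    ∃ u : S → 𝔸ˣ, (∀ z ∈ cube, ‖(u z : 𝔸)‖ ≤ 1 ∧ ‖(((u z)⁻¹ : 𝔸ˣ) : 𝔸)‖ ≤ 1) ∧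
      (∀ κ, ∀ z ∈ cube, ‖(gaugeTr T u U κ z : 𝔸) - 1‖ ≤ η * (C / ξ) * Real.exp (η * (C / ξ))) ∧
      (∀ κ ν, ∀ z ∈ cube, T κ z ∈ cube → ‖(gaugeTr T u U ν (T κ z) : 𝔸) - gaugeTr T u U ν z‖ ≤ η ^ 2 * (C / ξ ^ 2) * Real.exp (η * (C / ξ))) ∧
      (∀ κ μ (z z' : S), z ∈ cube → T κ z ∈ cube → z' ∈ cube → T κ z' ∈ cube → ∀ ρ : ℝ, 0 ≤ ρ → dist z z' ≤ ρ → ρ ≤ 1 → (z ≠ z' → 0 < dist z z') →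
        ‖((gaugeTr T u U μ (T κ z) : 𝔸) - gaugeTr T u U μ z) - ((gaugeTr T u U μ (T κ z') : 𝔸) - gaugeTr T u U μ z')‖ ≤
          η ^ 2 * ((Cβ * (ξ ^ (2 + β))⁻¹ * ρ ^ β + 2 * η * ((C / ξ) * (C / ξ ^ 2))) * Real.exp (5 * (η * (C / ξ))))) := by
  obtain ⟨u, A, hu, hg, hA, hD, hH⟩ := h
  obtain ⟨h1, h2⟩ := bondLetters_of_gauge335 T U hη hg hA hD
  exact ⟨u, hu, h1, h2, fun κ μ z z' hz hzκ hz' hz'κ ρ hρ0 hρ hρ1 hpos =>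
    pairLetter_of_gauge335Holder T U hη hξ hβ hCβ hg hA hD hH κ μ z z' hz hzκ hz' hz'κ hρ0 hρ hρ1 hpos⟩

end Generic

/-! ## §3 `𝔸 = M_n(ℂ)` (operator norm): a gauge unitary everywhere with the pointwise, step and pairwise four-point letters -/

section MatrixOp

open scoped Matrix.Norms.L2Operator
open Literature.MathematicalPhysics.QuantumFieldTheory.Balaban1983to89
open Literature.MathematicalPhysics.QuantumFieldTheory.Balaban1983to89.B9Eq39Adjoint (covD fluct)
open Literature.MathematicalPhysics.QuantumFieldTheory.Balaban1983to89.B9Eq3117Current (gaugeTr)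

variable {n : Type} [Fintype n] [DecidableEq n] [Nonempty n] {X J : Type} (τ : J → X ≃ X) (U : J → X → (Matrix n n ℂ)ˣ)

/-- ★★★ **FROM THE DATUM ON A SET: A GAUGE UNITARY EVERYWHERE WITH THE POINTWISE LETTER, THE ALL-DIRECTION STEP LETTER AND THE PAIRWISE FOUR-POINT LETTER OF THE TRANSFORMED
BOND VARIABLES** — `Reg335HolderCube τ U η Q ξ dist C β C_β` (`η > 0`, `β, C_β ≥ 0`) ⟹ ∃ `w`, `w(y)ᴴw(y) = 1` for all `y` (the datum's gauge on `Q`, `1` off `Q`), with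
`V_μ(z) = w(z)U_μ(z)w(z+e_μ)ᴴ`: (i) `‖V_μ(z) − 1‖ ≤ η(C∕ξ)e^{ηC∕ξ}` (`z, z+e_μ ∈ Q`); (ii) `‖V_μ(z+e_κ) − V_μ(z)‖ ≤ η²(C∕ξ²)e^{ηC∕ξ}` (`z, z+e_κ, z+e_μ, z+e_κ+e_μ ∈ Q`);
(iii) `‖(V_μ(z+e_κ) − V_μ(z)) − (V_μ(z′+e_κ) − V_μ(z′))‖ ≤ η²(C_βξ^{−(2+β)}ρ^β + 2η(C∕ξ)(C∕ξ²))e^{5ηC∕ξ}` whenever the base points `z, z+e_κ, z′, z′+e_κ` and their `μ`-neighbours lie in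
`Q`, `dist(z,z′) ≤ ρ ≤ 1`, `z ≠ z′ → 0 < dist(z,z′)`. [cite: Balaban1985BackgroundPropagators, (3.35) p.396 (shape), Cor. 3.6 p.408; Balaban1985Variational, Thm 1 (9) p.279 (shape)] -/
theorem uN_exists_gauge_pairLetters_of_reg335HolderCube {η : ℝ} (hη : 0 < η) {Q : Set X} {ξ : ℝ} (hξ : 0 < ξ) {dist : X → X → ℝ} {C β Cβ : ℝ} (hβ : 0 ≤ β) (hCβ : 0 ≤ Cβ)
    (h : Reg335HolderCube τ U η Q ξ dist C β Cβ) :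
    ∃ w : X → Matrix n n ℂ, (∀ y, (w y)ᴴ * w y = 1) ∧
      (∀ μ z, z ∈ Q → τ μ z ∈ Q → ‖w z * (U μ z : Matrix n n ℂ) * (w (τ μ z))ᴴ - 1‖ ≤ η * ((C / ξ) * Real.exp (η * (C / ξ)))) ∧
      (∀ κ μ z, z ∈ Q → τ κ z ∈ Q → τ μ z ∈ Q → τ μ (τ κ z) ∈ Q →
        ‖w (τ κ z) * (U μ (τ κ z) : Matrix n n ℂ) * (w (τ μ (τ κ z)))ᴴ - w z * (U μ z : Matrix n n ℂ) * (w (τ μ z))ᴴ‖ ≤ η ^ 2 * ((C / ξ ^ 2) * Real.exp (η * (C / ξ)))) ∧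
      (∀ κ μ (z z' : X), z ∈ Q → τ κ z ∈ Q → z' ∈ Q → τ κ z' ∈ Q → τ μ z ∈ Q → τ μ (τ κ z) ∈ Q → τ μ z' ∈ Q → τ μ (τ κ z') ∈ Q →
        ∀ ρ : ℝ, 0 ≤ ρ → dist z z' ≤ ρ → ρ ≤ 1 → (z ≠ z' → 0 < dist z z') →
        ‖(w (τ κ z) * (U μ (τ κ z) : Matrix n n ℂ) * (w (τ μ (τ κ z)))ᴴ - w z * (U μ z : Matrix n n ℂ) * (w (τ μ z))ᴴ) -
            (w (τ κ z') * (U μ (τ κ z') : Matrix n n ℂ) * (w (τ μ (τ κ z')))ᴴ - w z' * (U μ z' : Matrix n n ℂ) * (w (τ μ z'))ᴴ)‖ ≤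
          η ^ 2 * ((Cβ * (ξ ^ (2 + β))⁻¹ * ρ ^ β + 2 * η * ((C / ξ) * (C / ξ ^ 2))) * Real.exp (5 * (η * (C / ξ))))) := by
  classical
  obtain ⟨u, A, hu1, hg, hA, hD, hH⟩ := h
  obtain ⟨huQ, h1, h2⟩ := uN_opLetters_of_gauge335 (T := τ) U (cube := Q) hη hu1 hg hA hD
  have h3 := pairLetter_of_gauge335Holder (T := τ) U hη hξ hβ hCβ hg hA hD hH
  refine ⟨Q.piecewise (fun z => (u z : Matrix n n ℂ)) (fun _ => 1), fun y => ?_, fun μ z hz hz' => ?_, fun κ μ z hz hzκ hzμ hzκμ => ?_,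
    fun κ μ z z' hz hzκ hz' hz'κ hzμ hzκμ hz'μ hz'κμ ρ hρ0 hρ hρ1 hpos => ?_⟩
  · by_cases hy : y ∈ Q
    · rw [Set.piecewise_eq_of_mem _ _ _ hy]; exact Matrix.mem_unitaryGroup_iff'.mp (huQ y hy)
    · rw [Set.piecewise_eq_of_notMem _ _ _ hy, Matrix.conjTranspose_one, Matrix.mul_one]
  · rw [Set.piecewise_eq_of_mem _ _ _ hz, Set.piecewise_eq_of_mem _ _ _ hz', ← uN_val_gaugeTr_eq (T := τ) U (huQ (τ μ z) hz')]
    exact (h1 μ z hz).trans (le_of_eq (mul_assoc _ _ _))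
  · rw [Set.piecewise_eq_of_mem _ _ _ hz, Set.piecewise_eq_of_mem _ _ _ hzκ, Set.piecewise_eq_of_mem _ _ _ hzμ, Set.piecewise_eq_of_mem _ _ _ hzκμ,
      ← uN_val_gaugeTr_eq (T := τ) U (huQ (τ μ z) hzμ), ← uN_val_gaugeTr_eq (T := τ) U (huQ (τ μ (τ κ z)) hzκμ)]
    exact (h2 κ μ z hz hzκ).trans (le_of_eq (mul_assoc _ _ _))
  · rw [Set.piecewise_eq_of_mem _ _ _ hz, Set.piecewise_eq_of_mem _ _ _ hzκ, Set.piecewise_eq_of_mem _ _ _ hz', Set.piecewise_eq_of_mem _ _ _ hz'κ,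
      Set.piecewise_eq_of_mem _ _ _ hzμ, Set.piecewise_eq_of_mem _ _ _ hzκμ, Set.piecewise_eq_of_mem _ _ _ hz'μ, Set.piecewise_eq_of_mem _ _ _ hz'κμ,
      ← uN_val_gaugeTr_eq (T := τ) U (huQ (τ μ z) hzμ), ← uN_val_gaugeTr_eq (T := τ) U (huQ (τ μ (τ κ z)) hzκμ),
      ← uN_val_gaugeTr_eq (T := τ) U (huQ (τ μ z') hz'μ), ← uN_val_gaugeTr_eq (T := τ) U (huQ (τ μ (τ κ z')) hz'κμ)]
    exact h3 κ μ z z' hz hzκ hz' hz'κ hρ0 hρ hρ1 hpos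

/-! ## §4 Non-vacuity -/

/-- NON-VACUITY: the trivial background `U ≡ 1` with the trivial gauge `u ≡ 1` and `A ≡ 0` is in `Reg335HolderCube` on any set, any distance, all `ξ, C, C_β > 0`, every `η, β`.
[cite: Balaban1985BackgroundPropagators, (3.35) p.396 (shape); Balaban1985Variational, Thm 1 (9) p.279 (shape)] -/
theorem reg335HolderCube_one (η : ℝ) (Q : Set X) {ξ : ℝ} (dist : X → X → ℝ) {C β Cβ : ℝ} (hξ : 0 < ξ) (hC : 0 < C) (hCβ : 0 < Cβ) :
    Reg335HolderCube τ (fun (_ : J) (_ : X) => (1 : (Matrix n n ℂ)ˣ)) η Q ξ dist C β Cβ := by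
  refine ⟨fun _ => 1, fun _ _ => 0, fun z _ => ⟨?_, ?_⟩, fun κ z _ => ?_, fun κ z _ => ?_, fun κ ν z _ => ?_, fun κ ν z _ z' _ h0 _ => ?_⟩
  · rw [Units.val_one, norm_one]
  · rw [inv_one, Units.val_one, norm_one]
  · rw [gaugeTr]
    apply Units.ext
    rw [val_fluct]
    simp
  · simp only [norm_zero]; positivity
  · simp only [covD_one_apply', sub_self, smul_zero, norm_zero]; positivity
  · simp only [covD_one_apply', sub_self, smul_zero, norm_zero]
    exact mul_pos (mul_pos hCβ (inv_pos.mpr (Real.rpow_pos_of_pos hξ _))) (Real.rpow_pos_of_pos h0 _)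

end MatrixOp

end Summit.QuantumFields.YangMills.BalabanUVNodes.N15.CurvedSpecies

end
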